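import Literature.Probability.LatticeModels.RandomClusterProofs
import Literature.Probability.LatticeModels.FKIsingAnnulusCrossingProofs
import Literature.Probability.LatticeModels.RandomClusterDomainMarkov
import Literature.Barriers.CriticalPhenomena.RandomClusterFirstOrder
import HarnessLib

/-!
# Edwards–Sokal with plus boundary conditions: `φ¹_{Λ_{n+1},p,2}(0 ↔ ∂Λ_{n+1}) = ⟨σ_0⟩⁺_{Λ_n;β}`

Topic `Literature/Probability/LatticeModels`. The tree proves the Edwards–Sokal identity for the
*free* boundary condition (`edwardsSokal_twoPoint_holds`, `RandomClusterProofs.lean`). This file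
proves its **plus / wired** counterpart on boxes of `ℤ^d` (G. Grimmett, *The Random-Cluster
Model* (2006), Thm. 1.16 (`(1 - q⁻¹) φ¹(x ↔ ∂) + q⁻¹ = π¹(σ_x = 1)`-type identities, here `q = 2`,
Ising spins `±1`, so `⟨σ_0⟩⁺ = φ¹(0 ↔ ∂)`), with the wired boundary condition of §4.2,
(4.11)–(4.13)), which is the last line of the printed proof of S. Smirnov's a priori estimate
(Ann. of Math. 172 (2010), Appendix A, Lemma A.1: "= magnetization at `B` in the Ising spin
model in `Q` with `+` boundary conditions on `∂Q`"):

* `isingCorr_plus_box_eq_rcMeasure_real`: for `d ≥ 1`, `β ≥ 0`, `p = 1 - e^{-2β}`, the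
  plus-boundary magnetisation `⟨σ_0⟩⁺_{Λ_n;β,0}` (`isingCorr (zdGraph d) (box d n) β 0 .plus {0}`
  of `IsingModel.lean`: spins free on `Λ_n`, frozen to `+1` outside, interacting edges
  `ℰ^b_{Λ_n}`) equals the probability that the origin is joined to `∂Λ_{n+1}` under the
  random-cluster measure (`rcMeasure`, `q = 2`) of the spanning subgraph of the closed box
  `Λ_{n+1}` with edge set `ℰ^b_{Λ_n}` (`touchGraph`), wired on `∂Λ_{n+1}`;
* `thetaWiredBox_succ_eq_isingCorr_plus`: hence H21's wired box quantity
  `thetaWiredBox d p 2 (n + 1) = φ¹_{Λ_{n+1},p,2}(0 ↔ ∂Λ_{n+1})`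
  (`Literature.Barriers.CriticalPhenomena.RandomClusterFirstOrder`, all edges of `Λ_{n+1}`) equals
  `⟨σ_0⟩⁺_{Λ_n;β,0}`: the ring edges (both endpoints on the wired `∂Λ_{n+1}`) are integrated out
  by the domain Markov property with wired outside
  (`rcMeasure_real_eq_fromEdgeSet_of_outside_wired`, `FKIsingAnnulusCrossingProofs.lean`).

## Proof

As in `RandomClusterProofs` (Grimmett 2006, §1.4, (1.17)–(1.19), Thm. 1.16), on the finite
vertex type `↥Λ_{n+1}`: interior configurations `τ : Λ_n → {±1}` glued with `+1` are the
configurations of the closed box equal to `+1` on `∂Λ_{n+1}` (`plusExtEquiv`, `sum_plusExt_eq`);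
the Boltzmann weight `exp(β ∑_{e ∈ ℰ^b} σ_e)` is expanded over edge subsets
(`exp_mul_sum_bondSpin_eq`); the configurations equal to `+1` on the wired set and constant on
open clusters are the `{±1}`-colourings of the clusters of the *wired* open graph colouring the
wired cluster `+1`, `2^{k^∂(ω) - 1}` in number (`card_plusClusterConstant`), and summing `σ_0`
over them gives `2^{k^∂(ω)-1}` or `0` according as the origin is or is not joined to the wired
set (`sum_boole_plus_bondSpin_mul_spinAt_of_reachable`, `…_of_not_reachable`: flip the cluster of
the origin). The factor `2^{k-1}` versus the random-cluster weight `2^k` cancels in the ratio.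

## References

* G. Grimmett, *The Random-Cluster Model*, Springer 2006: §1.4 (1.17)–(1.19), Thm. 1.10,
  Thm. 1.16; §4.2 (4.11)–(4.13) — bib key `Grimmett2006`.
* R. G. Edwards, A. D. Sokal, Phys. Rev. D 38 (1988) 2009–2012 — bib key `EdwardsSokal1988`.
* S. Smirnov, Ann. of Math. 172 (2010), Appendix A, Lemma A.1 (last line of the proof) — bib key
  `Smirnov2010`.
* S. Friedli, Y. Velenik, *Statistical Mechanics of Lattice Systems* (2017), §3.1 (the volumes
  `Λ`, `ℰ_Λ^b`, `Ω_Λ^+`) — bib key `FriedliVelenik2017`.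
-/

noncomputable section

namespace Literature.Probability.LatticeModels

open MeasureTheory Finset SimpleGraph
open Literature.Barriers.CriticalPhenomena

section Counting

variable {V : Type*} [Fintype V] [DecidableEq V]

omit [Fintype V] [DecidableEq V] in
/-- A configuration equal to `1` on the wired set `W` and constant along the open edges of `ω`
is constant along the edges of the wired open graph `⟨ω⟩ ⊔ K_W`. [cite: Grimmett2006, §1.4 Thm. 1.10 and §4.2] -/
theorem apply_eq_of_adj_wired {ω : Finset (Sym2 V)} {W : Set V} {σ : SpinConfig V}
    (hW : ∀ w ∈ W, σ w = 1) (hω : ∀ e ∈ ω, bondSpin σ e = 1) {a b : V}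
    (hab : (Percolation.openGraph (↑ω : Percolation.BondConfig V) ⊔ wired W).Adj a b) : σ a = σ b := by
  rw [sup_adj, wired_adj] at hab
  rcases hab with h | ⟨-, ha, hb⟩
  · exact (forall_bondSpin_eq_one_iff ω σ).1 hω h
  · rw [hW a ha, hW b hb]

/-- **Counting the plus/cluster-constant configurations** (Grimmett 2006, (1.19) with a wired set,
proof of Thm. 1.16 / (4.12)): the `±1`-configurations equal to `+1` on a nonempty wired set `W`
and constant on the open clusters of `ω` are the `{±1}`-colourings of the clusters of the wired
open graph that colour the wired cluster `+1`; there are `2^{k^W(ω) - 1}` of them.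
[cite: Grimmett2006, §1.4 eq. (1.19) and §4.2 eq. (4.12)] -/
theorem card_plusClusterConstant (ω : Finset (Sym2 V)) {W : Set V} (hWne : W.Nonempty) :
    Nat.card {σ : SpinConfig V // (∀ w ∈ W, σ w = 1) ∧ ∀ e ∈ ω, bondSpin σ e = 1} =
      2 ^ (clusterCount (↑ω : Percolation.BondConfig V) W - 1) := by
  classical
  obtain ⟨w₀, hw₀⟩ := hWne
  set K := Percolation.openGraph (↑ω : Percolation.BondConfig V) ⊔ wired W with hK
  set C₀ := K.connectedComponentMk w₀ with hC₀
  have hWC : ∀ w ∈ W, K.connectedComponentMk w = C₀ := by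
    intro w hw
    rw [hC₀, ConnectedComponent.eq]
    by_cases hww : w = w₀
    · rw [hww]
    · refine Adj.reachable ?_
      rw [hK, sup_adj, wired_adj]
      exact Or.inr ⟨hww, hw, hw₀⟩
  -- configurations ↔ colourings of the clusters with the wired cluster coloured `+1`
  let e₁ : {σ : SpinConfig V // (∀ w ∈ W, σ w = 1) ∧ ∀ e ∈ ω, bondSpin σ e = 1} ≃
      {g : K.ConnectedComponent → ℤˣ // g C₀ = 1} :=
    { toFun := fun σ => ⟨ConnectedComponent.lift σ.1
          (fun a b p _ => apply_eq_of_reachable (fun x y h => apply_eq_of_adj_wired σ.2.1 σ.2.2 h) ⟨p⟩),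
          by rw [hC₀, ConnectedComponent.lift_mk]; exact σ.2.1 w₀ hw₀⟩
      invFun := fun g => ⟨fun v => g.1 (K.connectedComponentMk v), fun w hw => by
          show g.1 (K.connectedComponentMk w) = 1
          rw [hWC w hw]; exact g.2,
        (forall_bondSpin_eq_one_iff ω _).2 fun a b hab =>
          congrArg g.1 (ConnectedComponent.connectedComponentMk_eq_of_adj
            (show K.Adj a b from (sup_adj _ _ _ _).2 (Or.inl hab)))⟩
      left_inv := fun σ => rfl
      right_inv := fun g => by
        apply Subtype.ext
        funext C
        induction C using ConnectedComponent.ind with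
        | h v => rfl }
  -- colourings with a prescribed value ↔ colourings of the other clusters
  let e₂ : {g : K.ConnectedComponent → ℤˣ // g C₀ = 1} ≃ ({C : K.ConnectedComponent // C ≠ C₀} → ℤˣ) :=
    { toFun := fun g C => g.1 C.1
      invFun := fun h => ⟨fun C => if hC : C = C₀ then 1 else h ⟨C, hC⟩, by simp⟩
      left_inv := fun g => by
        apply Subtype.ext
        funext C
        by_cases hC : C = C₀
        · simp only [hC, ↓reduceDIte]; exact g.2.symm
        · simp only [hC, ↓reduceDIte]
      right_inv := fun h => by
        funext C
        simp only [C.2, ↓reduceDIte] }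
  rw [Nat.card_congr (e₁.trans e₂), Nat.card_fun, Nat.card_eq_fintype_card (α := ℤˣ),
    Fintype.card_units_int]
  congr 1
  -- the other clusters are `k - 1` in number
  have hsum := Nat.card_congr (Equiv.sumCompl fun C : K.ConnectedComponent => C ≠ C₀)
  rw [Nat.card_sum] at hsum
  have hone : Nat.card {C : K.ConnectedComponent // ¬ C ≠ C₀} = 1 := by
    rw [Nat.card_eq_one_iff_unique]
    exact ⟨⟨fun a b => Subtype.ext ((not_not.1 a.2).trans (not_not.1 b.2).symm)⟩, ⟨⟨C₀, fun h => h rfl⟩⟩⟩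
  rw [hone] at hsum
  unfold clusterCount
  rw [← hK]
  omega

/-- Grimmett 2006, (1.19)/(4.12) for `q = 2` with a plus/wired set, as a sum of indicators:
`∑_σ 1{σ = 1 on W} 1_F(σ, ω) = 2^{k^W(ω) - 1}`. [cite: Grimmett2006, §1.4 eq. (1.19) and §4.2 eq. (4.12)] -/
theorem sum_boole_plus_bondSpin_eq (ω : Finset (Sym2 V)) {W : Set V} [DecidablePred (· ∈ W)]
    (hWne : W.Nonempty) :
    ∑ σ : SpinConfig V, (if (∀ w ∈ W, σ w = 1) ∧ ∀ e ∈ ω, bondSpin σ e = 1 then (1 : ℝ) else 0) =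
      (2 : ℝ) ^ (clusterCount (↑ω : Percolation.BondConfig V) W - 1) := by
  classical
  rw [Finset.sum_boole, ← Fintype.card_subtype, ← Nat.card_eq_fintype_card,
    card_plusClusterConstant ω hWne]
  push_cast
  rfl

/-- If the origin `o` is joined to the wired set by open edges of `ω`, every plus/cluster-constant
configuration has `σ_o = 1`: `∑_σ 1{σ = 1 on W} 1_F(σ,ω) σ_o = 2^{k^W(ω) - 1}`.
[cite: Grimmett2006, §1.4 Thm. 1.16 (proof) and §4.2] -/
theorem sum_boole_plus_bondSpin_mul_spinAt_of_reachable (ω : Finset (Sym2 V)) {W : Set V}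
    [DecidablePred (· ∈ W)] (hWne : W.Nonempty) {o : V}
    (ho : ∃ y ∈ W, (Percolation.openGraph (↑ω : Percolation.BondConfig V)).Reachable o y) :
    ∑ σ : SpinConfig V, (if (∀ w ∈ W, σ w = 1) ∧ ∀ e ∈ ω, bondSpin σ e = 1 then (1 : ℝ) else 0) *
        spinAt o σ = (2 : ℝ) ^ (clusterCount (↑ω : Percolation.BondConfig V) W - 1) := by
  rw [← sum_boole_plus_bondSpin_eq ω hWne]
  refine Finset.sum_congr rfl fun σ _ => ?_
  split_ifs with h
  · obtain ⟨y, hy, hoy⟩ := ho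
    have hσ : σ o = σ y := apply_eq_of_reachable ((forall_bondSpin_eq_one_iff ω σ).1 h.2) hoy
    rw [one_mul, spinAt, hσ, h.1 y hy]
    simp
  · rw [zero_mul]

/-- If the origin `o` is **not** joined to the wired set by open edges of `ω`, flipping the open
cluster of `o` is an involution of the plus/cluster-constant configurations reversing `σ_o`:
`∑_σ 1{σ = 1 on W} 1_F(σ,ω) σ_o = 0`. [cite: Grimmett2006, §1.4 Thm. 1.16 (proof) and §4.2] -/
theorem sum_boole_plus_bondSpin_mul_spinAt_of_not_reachable (ω : Finset (Sym2 V)) {W : Set V}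
    [DecidablePred (· ∈ W)] {o : V}
    (ho : ¬ ∃ y ∈ W, (Percolation.openGraph (↑ω : Percolation.BondConfig V)).Reachable o y) :
    ∑ σ : SpinConfig V, (if (∀ w ∈ W, σ w = 1) ∧ ∀ e ∈ ω, bondSpin σ e = 1 then (1 : ℝ) else 0) *
        spinAt o σ = 0 := by
  classical
  set H : SimpleGraph V := Percolation.openGraph (↑ω : Percolation.BondConfig V) with hH
  set φ : SpinConfig V → SpinConfig V := fun σ v => if H.Reachable o v then -σ v else σ v with hφ
  have hφi : Function.Involutive φ := by
    intro σ
    funext v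
    by_cases hv : H.Reachable o v <;> simp [φ, hv]
  have key : ∀ {a b : V}, H.Adj a b → (H.Reachable o a ↔ H.Reachable o b) := fun hab =>
    ⟨fun h => h.trans hab.reachable, fun h => h.trans hab.symm.reachable⟩
  have hWfix : ∀ σ : SpinConfig V, ∀ w ∈ W, φ σ w = σ w := by
    intro σ w hw
    have : ¬ H.Reachable o w := fun h => ho ⟨w, hw, h⟩
    simp only [hφ, this, if_false]
  have hF : ∀ σ : SpinConfig V, (∀ e ∈ ω, bondSpin (φ σ) e = 1) ↔ ∀ e ∈ ω, bondSpin σ e = 1 := by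
    intro σ
    rw [forall_bondSpin_eq_one_iff, forall_bondSpin_eq_one_iff]
    constructor
    · intro h a b hab
      have hab' := h hab
      by_cases ha : H.Reachable o a
      · have hb : H.Reachable o b := (key hab).1 ha
        simp only [φ, if_pos ha, if_pos hb, neg_inj] at hab'
        exact hab'
      · have hb : ¬ H.Reachable o b := fun hb => ha ((key hab).2 hb)
        simp only [φ, if_neg ha, if_neg hb] at hab'
        exact hab'
    · intro h a b hab
      by_cases ha : H.Reachable o a
      · have hb : H.Reachable o b := (key hab).1 ha
        simp only [φ, if_pos ha, if_pos hb, h hab]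
      · have hb : ¬ H.Reachable o b := fun hb => ha ((key hab).2 hb)
        simp only [φ, if_neg ha, if_neg hb, h hab]
  have hP : ∀ σ : SpinConfig V, ((∀ w ∈ W, φ σ w = 1) ∧ ∀ e ∈ ω, bondSpin (φ σ) e = 1) ↔
      ((∀ w ∈ W, σ w = 1) ∧ ∀ e ∈ ω, bondSpin σ e = 1) := by
    intro σ
    rw [hF σ]
    refine and_congr_left fun _ => ?_
    exact forall₂_congr fun w hw => by rw [hWfix σ w hw]
  have hsp : ∀ σ : SpinConfig V, spinAt o (φ σ) = -spinAt o σ := by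
    intro σ
    simp only [spinAt, φ, if_pos (SimpleGraph.Reachable.refl o), Units.val_neg, Int.cast_neg]
  have hS := (Fintype.sum_equiv (Function.Involutive.toPerm φ hφi)
    (fun σ => (if (∀ w ∈ W, φ σ w = 1) ∧ ∀ e ∈ ω, bondSpin (φ σ) e = 1 then (1 : ℝ) else 0) *
      spinAt o (φ σ))
    (fun σ => (if (∀ w ∈ W, σ w = 1) ∧ ∀ e ∈ ω, bondSpin σ e = 1 then (1 : ℝ) else 0) * spinAt o σ)
    fun σ => rfl)
  simp_rw [hP, hsp, mul_neg, Finset.sum_neg_distrib] at hS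
  linarith

end Counting


/-! ### The plus-boundary Ising model on a box as a model on the finite type of the closed box -/

section PlusBox

variable (d n : ℕ)

open scoped Classical in
/-- The edges of the closed box `Λ_{n+1}` touching the open box `Λ_n` (at least one endpoint in
`Λ_n`), as edges of the finite vertex type `↥Λ_{n+1}`: the interacting edges `ℰ^b_{Λ_n}` of the
plus-boundary model, and the spanning subgraph on which its FK representation lives.
[cite: FriedliVelenik2017, §3.1 (ℰ_Λ^b)] -/
def touchEdges : Finset (Sym2 (BoxV d (n + 1))) :=
  (boxGraph d (n + 1)).edgeFinset.filter fun e => ∃ y ∈ e, y.1 ∈ box d n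

/-- The spanning subgraph of the box `Λ_{n+1}` with edge set `touchEdges d n`. [cite: Grimmett2006, §1.4 and §4.2] -/
def touchGraph : SimpleGraph (BoxV d (n + 1)) :=
  fromEdgeSet (↑(touchEdges d n) : Set (Sym2 (BoxV d (n + 1))))

/-- Adjacency of the spanning subgraph is decidable (classically). [folklore] -/
instance : DecidableRel (touchGraph d n).Adj := Classical.decRel _

/-- The plus extension of an interior configuration `τ : Λ_n → {±1}` to the closed box
`Λ_{n+1}`: `τ` on `Λ_n`, `+1` on `∂Λ_{n+1} = Λ_{n+1} ∖ Λ_n`. [cite: FriedliVelenik2017, §3.1 (Ω_Λ^+)] -/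
def plusExt (τ : ↥(box d n) → ℤˣ) : SpinConfig (BoxV d (n + 1)) :=
  fun y => if h : y.1 ∈ box d n then τ ⟨y.1, h⟩ else 1

variable {d n}

/-- The touching edges are edges of the box graph. [folklore] -/
theorem touchEdges_subset : touchEdges d n ⊆ (boxGraph d (n + 1)).edgeFinset :=
  Finset.filter_subset _ _

/-- The edge set of the spanning subgraph is `touchEdges`. [folklore] -/
theorem edgeFinset_touchGraph : (touchGraph d n).edgeFinset = touchEdges d n := by
  classical
  unfold touchGraph
  convert edgeFinset_fromEdgeSet_of_subset (boxGraph d (n + 1)) (touchEdges d n) touchEdges_subset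

/-- A lattice neighbour of a point of `Λ_n` lies in `Λ_{n+1}` (local copy of the lemma of
`RandomClusterDomainToBox`). [folklore] -/
private theorem mem_box_succ_of_adj' {x y : Site d} (hxy : (zdGraph d).Adj x y) (hx : x ∈ box d n) :
    y ∈ box d (n + 1) := by
  rw [mem_box] at hx ⊢
  rcases (zdGraph_adj_iff x y).1 hxy with ⟨i, rfl | h⟩
  · intro k
    have := hx k
    by_cases hk : k = i
    · subst hk; simp only [Pi.add_apply, Pi.single_eq_same]; push_cast; omega
    · simp only [Pi.add_apply, Pi.single_eq_of_ne hk, add_zero]; push_cast; omega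
  · subst h
    intro k
    have := hx k
    by_cases hk : k = i
    · subst hk; simp only [Pi.add_apply, Pi.single_eq_same] at this; push_cast; omega
    · simp only [Pi.add_apply, Pi.single_eq_of_ne hk, add_zero] at this; push_cast; omega

/-- A vertex of the closed box lies on `∂Λ_{n+1}` iff it is not in the open box `Λ_n`.
[cite: Grimmett2006, §4.2 (∂Λ)] -/
theorem mem_boxBoundary_iff_notMem (y : BoxV d (n + 1)) : y ∈ boxBoundary d (n + 1) ↔ y.1 ∉ box d n := by
  constructor
  · intro hy hyn
    obtain ⟨-, z, hz, hyz⟩ := mem_innerBoundary_iff.1 hy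
    exact hz (mem_box_succ_of_adj' hyz hyn)
  · intro hyn
    have hy := y.2
    rw [mem_box] at hy
    rw [mem_box, not_forall] at hyn
    obtain ⟨i, hi⟩ := hyn
    rcases not_and_or.1 hi with h | h
    · exact mem_innerBoundary_box_of_apply_eq_neg y.2 i (by have := (hy i).1; push_cast at this ⊢; omega)
    · exact mem_innerBoundary_box_of_apply_eq y.2 i (by have := (hy i).2; push_cast at this ⊢; omega)

/-- **The interacting edges of the plus-boundary model are the touching edges of the closed box.**
[cite: FriedliVelenik2017, §3.1 (ℰ_Λ^b)] -/
theorem touchEdges_map :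
    (touchEdges d n).map (Function.Embedding.subtype _).sym2Map = edgesTouching (zdGraph d) (box d n) := by
  classical
  ext e
  rw [Finset.mem_map, mem_edgesTouching_iff]
  constructor
  · rintro ⟨e', he', rfl⟩
    rw [touchEdges, Finset.mem_filter, mem_edgeFinset] at he'
    obtain ⟨hadj, y, hy, hyn⟩ := he'
    induction e' using Sym2.ind with
    | h a b =>
      rw [Function.Embedding.sym2Map_apply, Sym2.map_mk]
      refine ⟨hadj, y.1, hyn, ?_⟩
      rcases Sym2.mem_iff.1 hy with rfl | rfl
      · exact Sym2.mem_mk_left _ _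
      · exact Sym2.mem_mk_right _ _
  · rintro ⟨he, x, hx, hxe⟩
    induction e using Sym2.ind with
    | h a b =>
      rw [mem_edgeSet] at he
      have hab : a ∈ box d (n + 1) ∧ b ∈ box d (n + 1) := by
        rcases Sym2.mem_iff.1 hxe with rfl | rfl
        · exact ⟨box_mono d (Nat.le_succ n) hx, mem_box_succ_of_adj' he hx⟩
        · exact ⟨mem_box_succ_of_adj' he.symm hx, box_mono d (Nat.le_succ n) hx⟩
      refine ⟨s(⟨a, hab.1⟩, ⟨b, hab.2⟩), ?_, ?_⟩
      · rw [touchEdges, Finset.mem_filter, mem_edgeFinset]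
        refine ⟨he, ?_⟩
        rcases Sym2.mem_iff.1 hxe with rfl | rfl
        · exact ⟨⟨x, hab.1⟩, Sym2.mem_mk_left _ _, hx⟩
        · exact ⟨⟨x, hab.2⟩, Sym2.mem_mk_right _ _, hx⟩
      · rw [Function.Embedding.sym2Map_apply, Sym2.map_mk]
        rfl

/-- The glued plus configuration, read on the closed box, is the plus extension. [cite: FriedliVelenik2017, §3.1] -/
theorem glue_plus_apply (τ : ↥(box d n) → ℤˣ) (y : BoxV d (n + 1)) :
    glue (box d n) τ .plus y.1 = plusExt d n τ y := by
  unfold plusExt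
  by_cases h : y.1 ∈ box d n
  · rw [glue_apply_of_mem _ _ _ h, dif_pos h]
  · rw [glue_apply_of_notMem _ _ _ h, dif_neg h]
    rfl

/-- Spins of the glued plus configuration at points of the closed box. [cite: FriedliVelenik2017, §3.1] -/
theorem spinAt_glue_plus (τ : ↥(box d n) → ℤˣ) (y : BoxV d (n + 1)) :
    spinAt y.1 (glue (box d n) τ .plus) = spinAt y (plusExt d n τ) := by
  simp only [spinAt, glue_plus_apply]

/-- Bond spins of the glued plus configuration on lifted edges. [cite: FriedliVelenik2017, §3.1] -/
theorem bondSpin_glue_plus_sym2Map (τ : ↥(box d n) → ℤˣ) (e : Sym2 (BoxV d (n + 1))) :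
    bondSpin (glue (box d n) τ .plus) ((Function.Embedding.subtype _).sym2Map e) =
      bondSpin (plusExt d n τ) e := by
  induction e using Sym2.ind with
  | h a b => rw [Function.Embedding.sym2Map_apply, Sym2.map_mk, bondSpin_mk, bondSpin_mk,
      Function.Embedding.coe_subtype, spinAt_glue_plus, spinAt_glue_plus]

/-- **The plus-boundary Boltzmann weight of the box, on the closed box**: at zero field,
`w⁺_{Λ_n}(τ) = exp(β ∑_{e ∈ touchEdges} σ_e(τ⁺))`. [cite: FriedliVelenik2017, §3.1, eqs. (3.6)–(3.7)] -/
theorem isingWeight_plus_box_eq (β : ℝ) (τ : ↥(box d n) → ℤˣ) :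
    isingWeight (zdGraph d) (box d n) β 0 .plus τ =
      Real.exp (β * ∑ e ∈ touchEdges d n, bondSpin (plusExt d n τ) e) := by
  have hI : interactionEdges (zdGraph d) (box d n) .plus = edgesTouching (zdGraph d) (box d n) := rfl
  rw [isingWeight, isingHamiltonian, hI, ← touchEdges_map, Finset.sum_map]
  simp only [zero_mul, sub_zero, mul_neg, neg_mul, neg_neg, bondSpin_glue_plus_sym2Map]

/-- Interior configurations ↔ configurations of the closed box equal to `+1` on `∂Λ_{n+1}`.
[cite: FriedliVelenik2017, §3.1 (Ω_Λ^+)] -/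
def plusExtEquiv : (↥(box d n) → ℤˣ) ≃
    {σ : SpinConfig (BoxV d (n + 1)) // ∀ w ∈ boxBoundary d (n + 1), σ w = 1} where
  toFun τ := ⟨plusExt d n τ, fun w hw => by
    unfold plusExt
    rw [dif_neg ((mem_boxBoundary_iff_notMem w).1 hw)]⟩
  invFun σ := fun x => σ.1 ⟨x.1, box_mono d (Nat.le_succ n) x.2⟩
  left_inv τ := by
    funext x
    simp only [plusExt, x.2, ↓reduceDIte]
  right_inv σ := by
    apply Subtype.ext
    funext y
    simp only [plusExt]
    by_cases h : y.1 ∈ box d n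
    · rw [dif_pos h]
    · rw [dif_neg h]
      exact (σ.2 y ((mem_boxBoundary_iff_notMem y).2 h)).symm

open scoped Classical in
/-- Sums over interior configurations are sums over the plus configurations of the closed box.
[cite: FriedliVelenik2017, §3.1] -/
theorem sum_plusExt_eq (G : SpinConfig (BoxV d (n + 1)) → ℝ) :
    ∑ τ : ↥(box d n) → ℤˣ, G (plusExt d n τ) =
      ∑ σ : SpinConfig (BoxV d (n + 1)), if ∀ w ∈ boxBoundary d (n + 1), σ w = 1 then G σ else 0 := by
  classical
  rw [← Finset.sum_filter,
    Finset.sum_subtype (p := fun σ : SpinConfig (BoxV d (n + 1)) => ∀ w ∈ boxBoundary d (n + 1), σ w = 1)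
      (Finset.univ.filter fun σ : SpinConfig (BoxV d (n + 1)) => ∀ w ∈ boxBoundary d (n + 1), σ w = 1)
      (fun σ => by rw [Finset.mem_filter]; exact ⟨fun h => h.2, fun h => ⟨Finset.mem_univ _, h⟩⟩) G]
  exact Fintype.sum_equiv plusExtEquiv _ _ fun τ => rfl

end PlusBox


/-! ### Edwards–Sokal for the plus-boundary box: `⟨σ_0⟩⁺_{Λ_n} = φ^{∂}_{⟨ℰ^b⟩}(0 ↔ ∂Λ_{n+1})` -/

section EdwardsSokalPlus

variable {d n : ℕ}

/-- Exchange of the configuration sum and the edge-set sum, with the plus constraint.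
[cite: Grimmett2006, §1.4 Thm. 1.16 (proof)] -/
private theorem sum_ite_mul_sum_exchange {ι κ : Type*} [Fintype ι] (t : Finset κ) (c : ℝ)
    (Wt : κ → ℝ) (P : ι → Prop) [DecidablePred P] (Fc : ι → κ → Prop) [∀ i k, Decidable (Fc i k)]
    (s : ι → ℝ) :
    ∑ i, (if P i then (c * ∑ k ∈ t, Wt k * (if Fc i k then 1 else 0)) * s i else 0) =
      c * ∑ k ∈ t, Wt k * ∑ i, (if P i ∧ Fc i k then (1 : ℝ) else 0) * s i := by
  have step : ∀ i, (if P i then (c * ∑ k ∈ t, Wt k * (if Fc i k then 1 else 0)) * s i else 0) =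
      ∑ k ∈ t, c * (Wt k * ((if P i ∧ Fc i k then (1 : ℝ) else 0) * s i)) := by
    intro i
    by_cases hP : P i
    · simp only [hP, if_true, true_and, Finset.mul_sum, Finset.sum_mul]
      refine Finset.sum_congr rfl fun k _ => ?_
      ring
    · simp only [hP, if_false, false_and, zero_mul, mul_zero, Finset.sum_const_zero]
  calc ∑ i, (if P i then (c * ∑ k ∈ t, Wt k * (if Fc i k then 1 else 0)) * s i else 0)
      = ∑ i, ∑ k ∈ t, c * (Wt k * ((if P i ∧ Fc i k then (1 : ℝ) else 0) * s i)) :=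
        Finset.sum_congr rfl fun i _ => step i
    _ = ∑ k ∈ t, ∑ i, c * (Wt k * ((if P i ∧ Fc i k then (1 : ℝ) else 0) * s i)) := Finset.sum_comm
    _ = c * ∑ k ∈ t, Wt k * ∑ i, (if P i ∧ Fc i k then (1 : ℝ) else 0) * s i := by
        rw [Finset.mul_sum]
        refine Finset.sum_congr rfl fun k _ => ?_
        rw [Finset.mul_sum, Finset.mul_sum]

/-- The wired cluster count of a configuration on a nonempty finite vertex type is positive.
[folklore] -/
theorem clusterCount_pos {V : Type*} [Fintype V] [Nonempty V] (ω : Percolation.BondConfig V) (W : Set V) :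
    0 < clusterCount ω W := by
  unfold clusterCount
  haveI : Nonempty (Percolation.openGraph ω ⊔ wired W).ConnectedComponent :=
    ⟨(Percolation.openGraph ω ⊔ wired W).connectedComponentMk (Classical.arbitrary V)⟩
  exact Nat.card_pos

/-- **Edwards–Sokal with plus boundary conditions** (Grimmett 2006, Thm. 1.16 and §4.2, (4.12),
for `q = 2` with Ising spins `±1`; Edwards–Sokal 1988): for `β ≥ 0` and `d ≥ 1`, the plus-boundary
magnetisation of the box `Λ_n ⊆ ℤ^d` at the origin equals the probability, under the
random-cluster measure with `p = 1 - e^{-2β}`, `q = 2` of the spanning graph of the closed box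
`Λ_{n+1}` with edge set `ℰ^b_{Λ_n}` (edges touching `Λ_n`) wired on `∂Λ_{n+1}`, that the origin
is joined to `∂Λ_{n+1}` by an open path:
`⟨σ_0⟩⁺_{Λ_n;β,0} = φ^{∂Λ_{n+1}}_{⟨ℰ^b⟩,p,2}(0 ↔ ∂Λ_{n+1})`. Proof: write both sides as finite
sums, expand the Boltzmann weight over edge subsets (`exp_mul_sum_bondSpin_eq`), exchange the
sums and count the plus/cluster-constant configurations (`sum_boole_plus_bondSpin_eq`,
`…_mul_spinAt_of_reachable`, `…_of_not_reachable`). [cite: Grimmett2006, Thm. 1.16 and §4.2 eq. (4.12); EdwardsSokal1988] -/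
theorem isingCorr_plus_box_eq_rcMeasure_real (hd : 0 < d) {β : ℝ} (hβ : 0 ≤ β) (n : ℕ) :
    isingCorr (zdGraph d) (box d n) β 0 .plus {0} =
      (rcMeasure (touchGraph d n) (fkIsingParam β) 2 (boxBoundary d (n + 1))).real
        {ω | ∃ y ∈ boxBoundary d (n + 1),
          (Percolation.openGraph ω).Reachable (boxOrigin d (n + 1)) y} := by
  classical
  set W := boxBoundary d (n + 1) with hW
  set o := boxOrigin d (n + 1) with ho
  set T := touchEdges d n with hT
  set p := fkIsingParam β with hpdef
  set A : Set (Percolation.BondConfig (BoxV d (n + 1))) :=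
    {ω | ∃ y ∈ W, (Percolation.openGraph ω).Reachable o y} with hA
  have hWne : W.Nonempty := by
    obtain ⟨x, hx⟩ := innerBoundary_box_nonempty hd (n + 1)
    exact ⟨⟨x, (mem_innerBoundary_iff.1 hx).1⟩, hx⟩
  have hp : p ∈ Set.Icc (0 : ℝ) 1 := fkIsingParam_mem_Icc hβ
  have hq : (0 : ℝ) < 2 := two_pos
  have hET : (touchGraph d n).edgeFinset = T := edgeFinset_touchGraph
  have hc : (0 : ℝ) < Real.exp β ^ #T := pow_pos (Real.exp_pos β) _
  -- the weights
  set Wt : Finset (Sym2 (BoxV d (n + 1))) → ℝ := fun ω => p ^ #ω * (1 - p) ^ #(T \ ω) with hWt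
  set K : Finset (Sym2 (BoxV d (n + 1))) → ℕ :=
    fun ω => clusterCount (↑ω : Percolation.BondConfig (BoxV d (n + 1))) W with hK
  haveI : Nonempty (BoxV d (n + 1)) := ⟨boxOrigin d (n + 1)⟩
  have h2K : ∀ ω, (2 : ℝ) ^ K ω = 2 * 2 ^ (K ω - 1) := by
    intro ω
    have hpos : 0 < K ω := clusterCount_pos _ _
    conv_lhs => rw [show K ω = (K ω - 1) + 1 by omega, pow_succ]
    ring
  -- the Ising side as a ratio of finite sums over interior configurations
  have hspin : spinProduct ({0} : Finset (Site d)) = spinAt 0 := by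
    funext σ; simp [spinProduct]
  have hL : isingCorr (zdGraph d) (box d n) β 0 .plus {0} =
      (∑ τ : ↥(box d n) → ℤˣ, isingWeight (zdGraph d) (box d n) β 0 .plus τ *
          spinAt 0 (glue (box d n) τ .plus)) /
        ∑ τ : ↥(box d n) → ℤˣ, isingWeight (zdGraph d) (box d n) β 0 .plus τ := by
    rw [isingCorr, isingExpect, hspin, integral_isingMeasure _ _ _ _ _ (measurable_spinAt 0),
      isingPartitionFunction]
  -- both sums transferred to the closed box and expanded over edge sets
  have hexp : ∀ σ : SpinConfig (BoxV d (n + 1)), Real.exp (β * ∑ e ∈ T, bondSpin σ e) =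
      Real.exp β ^ #T * ∑ ω ∈ T.powerset, Wt ω * (if ∀ e ∈ ω, bondSpin σ e = 1 then 1 else 0) := by
    intro σ
    have h := exp_mul_sum_bondSpin_eq (touchGraph d n) β σ
    rw [hET] at h
    rw [h]
  have hNum : ∑ τ : ↥(box d n) → ℤˣ, isingWeight (zdGraph d) (box d n) β 0 .plus τ *
        spinAt 0 (glue (box d n) τ .plus) =
      Real.exp β ^ #T * ∑ ω ∈ T.powerset, Wt ω *
        ∑ σ : SpinConfig (BoxV d (n + 1)),
          (if (∀ w ∈ W, σ w = 1) ∧ ∀ e ∈ ω, bondSpin σ e = 1 then (1 : ℝ) else 0) * spinAt o σ := by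
    have h1 : ∀ τ : ↥(box d n) → ℤˣ, isingWeight (zdGraph d) (box d n) β 0 .plus τ *
          spinAt 0 (glue (box d n) τ .plus) =
        (fun σ => Real.exp (β * ∑ e ∈ T, bondSpin σ e) * spinAt o σ) (plusExt d n τ) := by
      intro τ
      simp only [isingWeight_plus_box_eq, ← hT]
      rw [show spinAt 0 (glue (box d n) τ .plus) = spinAt o (plusExt d n τ) from spinAt_glue_plus τ o]
    simp_rw [h1]
    have h2 := sum_plusExt_eq (d := d) (n := n) (fun σ => Real.exp (β * ∑ e ∈ T, bondSpin σ e) * spinAt o σ)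
    rw [h2]
    simp_rw [hexp]
    exact sum_ite_mul_sum_exchange _ _ _ _ _ _
  have hDen : ∑ τ : ↥(box d n) → ℤˣ, isingWeight (zdGraph d) (box d n) β 0 .plus τ =
      Real.exp β ^ #T * ∑ ω ∈ T.powerset, Wt ω *
        ∑ σ : SpinConfig (BoxV d (n + 1)),
          (if (∀ w ∈ W, σ w = 1) ∧ ∀ e ∈ ω, bondSpin σ e = 1 then (1 : ℝ) else 0) * 1 := by
    have h1 : ∀ τ : ↥(box d n) → ℤˣ, isingWeight (zdGraph d) (box d n) β 0 .plus τ =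
        (fun σ => Real.exp (β * ∑ e ∈ T, bondSpin σ e) * 1) (plusExt d n τ) := by
      intro τ
      simp only [isingWeight_plus_box_eq, ← hT, mul_one]
    simp_rw [h1]
    have h2 := sum_plusExt_eq (d := d) (n := n) (fun σ => Real.exp (β * ∑ e ∈ T, bondSpin σ e) * 1)
    rw [h2]
    simp_rw [hexp]
    exact sum_ite_mul_sum_exchange _ _ _ _ _ (fun _ => 1)
  -- evaluate the configuration sums
  have hNum' : ∑ τ : ↥(box d n) → ℤˣ, isingWeight (zdGraph d) (box d n) β 0 .plus τ *
        spinAt 0 (glue (box d n) τ .plus) =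
      Real.exp β ^ #T * ∑ ω ∈ T.powerset, Wt ω * ((2 : ℝ) ^ (K ω - 1) *
        (if (↑ω : Percolation.BondConfig (BoxV d (n + 1))) ∈ A then 1 else 0)) := by
    rw [hNum]
    refine congrArg (Real.exp β ^ #T * ·) (Finset.sum_congr rfl fun ω _ => ?_)
    refine congrArg (Wt ω * ·) ?_
    by_cases hAω : (↑ω : Percolation.BondConfig (BoxV d (n + 1))) ∈ A
    · rw [if_pos hAω, mul_one]
      exact sum_boole_plus_bondSpin_mul_spinAt_of_reachable ω hWne hAω
    · rw [if_neg hAω, mul_zero]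
      exact sum_boole_plus_bondSpin_mul_spinAt_of_not_reachable ω hAω
  have hDen' : ∑ τ : ↥(box d n) → ℤˣ, isingWeight (zdGraph d) (box d n) β 0 .plus τ =
      Real.exp β ^ #T * ∑ ω ∈ T.powerset, Wt ω * (2 : ℝ) ^ (K ω - 1) := by
    rw [hDen]
    refine congrArg (Real.exp β ^ #T * ·) (Finset.sum_congr rfl fun ω _ => ?_)
    refine congrArg (Wt ω * ·) ?_
    simp only [mul_one]
    exact sum_boole_plus_bondSpin_eq ω hWne
  -- the random-cluster side
  have hR : (rcMeasure (touchGraph d n) p 2 W).real A =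
      (∑ ω ∈ T.powerset, if (↑ω : Percolation.BondConfig (BoxV d (n + 1))) ∈ A then
          Wt ω * (2 : ℝ) ^ K ω else 0) /
        ∑ ω ∈ T.powerset, Wt ω * (2 : ℝ) ^ K ω := by
    have hw : ∀ ω, rcWeight (touchGraph d n) p 2 W ω = Wt ω * (2 : ℝ) ^ K ω := by
      intro ω
      rw [rcWeight, hET]
    rw [rcMeasure_real_eq_sum_div _ hp hq, rcPartitionFunction, hET]
    simp only [hw]
  -- compare
  rw [hL, hNum', hDen', mul_div_mul_left _ _ hc.ne', hR]
  have e1 : ∑ ω ∈ T.powerset, (if (↑ω : Percolation.BondConfig (BoxV d (n + 1))) ∈ A then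
        Wt ω * (2 : ℝ) ^ K ω else 0) =
      2 * ∑ ω ∈ T.powerset, Wt ω * ((2 : ℝ) ^ (K ω - 1) *
        (if (↑ω : Percolation.BondConfig (BoxV d (n + 1))) ∈ A then 1 else 0)) := by
    rw [Finset.mul_sum]
    refine Finset.sum_congr rfl fun ω _ => ?_
    rw [h2K]
    split_ifs <;> ring
  have e2 : ∑ ω ∈ T.powerset, Wt ω * (2 : ℝ) ^ K ω = 2 * ∑ ω ∈ T.powerset, Wt ω * (2 : ℝ) ^ (K ω - 1) := by
    rw [Finset.mul_sum]
    refine Finset.sum_congr rfl fun ω _ => ?_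
    rw [h2K]
    ring
  rw [e1, e2, mul_div_mul_left _ _ (two_ne_zero)]

/-- The event `{0 ↔ ∂Λ_{n+1}}` only depends on the edges touching `Λ_n`: an open path from the
origin reaches `∂Λ_{n+1}` for the first time through edges with an endpoint in `Λ_n`.
[cite: Grimmett2006, Prop. (5.11) (proof)] -/
theorem exists_reachable_boxBoundary_inter_touchEdges {ω : Finset (Sym2 (BoxV d (n + 1)))}
    (hω : ω ⊆ (boxGraph d (n + 1)).edgeFinset) {x : BoxV d (n + 1)}
    (h : ∃ y ∈ boxBoundary d (n + 1),
      (Percolation.openGraph (↑ω : Percolation.BondConfig (BoxV d (n + 1)))).Reachable x y) :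
    ∃ y ∈ boxBoundary d (n + 1),
      (Percolation.openGraph (↑(ω ∩ touchEdges d n) : Percolation.BondConfig (BoxV d (n + 1)))).Reachable x y := by
  classical
  obtain ⟨y, hy, ⟨p⟩⟩ := h
  induction p with
  | nil => exact ⟨_, hy, Reachable.refl _⟩
  | @cons a b c hadj p' ih =>
    by_cases ha : a ∈ boxBoundary d (n + 1)
    · exact ⟨a, ha, Reachable.refl _⟩
    · obtain ⟨y', hy', hreach⟩ := ih hy
      have han : a.1 ∈ box d n := not_not.1 (mt (mem_boxBoundary_iff_notMem a).2 ha)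
      rw [Percolation.openGraph_adj, Finset.mem_coe] at hadj
      have hT : s(a, b) ∈ touchEdges d n := by
        rw [touchEdges, Finset.mem_filter]
        exact ⟨hω hadj.1, a, Sym2.mem_mk_left _ _, han⟩
      have hstep : (Percolation.openGraph (↑(ω ∩ touchEdges d n) :
          Percolation.BondConfig (BoxV d (n + 1)))).Adj a b := by
        rw [Percolation.openGraph_adj, Finset.mem_coe, Finset.mem_inter]
        exact ⟨⟨hadj.1, hT⟩, hadj.2⟩
      exact ⟨y', hy', hstep.reachable.trans hreach⟩

/-- **The wired box one-arm probability is a plus-boundary Ising magnetisation**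
(Grimmett 2006, Thm. 1.16 with (4.12)–(4.13); the last line of Smirnov 2010, App. A, proof of
Lemma A.1): for `d ≥ 1`, `β ≥ 0` and `p = 1 - e^{-2β}`,
`φ¹_{Λ_{n+1},p,2}(0 ↔ ∂Λ_{n+1}) = ⟨σ_0⟩⁺_{Λ_n;β,0}`. The ring edges of `Λ_{n+1}` (both endpoints
on the wired `∂Λ_{n+1}`) are integrated out by the domain Markov property with wired outside
(`rcMeasure_real_eq_fromEdgeSet_of_outside_wired`), leaving the Edwards–Sokal identity
`isingCorr_plus_box_eq_rcMeasure_real`. [cite: Grimmett2006, Thm. 1.16 and §4.2 eqs. (4.12)–(4.13)] -/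
theorem thetaWiredBox_succ_eq_isingCorr_plus (hd : 0 < d) {β : ℝ} (hβ : 0 ≤ β) (n : ℕ) :
    thetaWiredBox d (fkIsingParam β) 2 (n + 1) = isingCorr (zdGraph d) (box d n) β 0 .plus {0} := by
  classical
  have hp : fkIsingParam β ∈ Set.Icc (0 : ℝ) 1 := fkIsingParam_mem_Icc hβ
  rw [isingCorr_plus_box_eq_rcMeasure_real hd hβ n, thetaWiredBox]
  have h := rcMeasure_real_eq_fromEdgeSet_of_outside_wired (boxGraph d (n + 1)) hp two_pos
    (boxBoundary d (n + 1)) (touchEdges d n) touchEdges_subset ?_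
    (A := {ω | ∃ y ∈ boxBoundary d (n + 1),
      (Percolation.openGraph ω).Reachable (boxOrigin d (n + 1)) y}) ?_
  · rw [h]
    unfold touchGraph
    congr!
  · intro e he heT x hx
    rw [mem_boxBoundary_iff_notMem]
    intro hxn
    exact heT (by rw [touchEdges, Finset.mem_filter]; exact ⟨he, x, hx, hxn⟩)
  · intro ω hω
    constructor
    · exact exists_reachable_boxBoundary_inter_touchEdges hω
    · rintro ⟨y, hy, hreach⟩
      refine ⟨y, hy, hreach.mono ?_⟩
      unfold Percolation.openGraph
      exact fromEdgeSet_mono (Finset.coe_subset.2 Finset.inter_subset_left)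

end EdwardsSokalPlus

end Literature.Probability.LatticeModels

end
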